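import Mathlib
import Literature.NumberTheory.Irrationality.BrownZudilin2022.CubicalForm
import Summits.KontsevichZagierPeriods.Zeta5Search.CubicalSubstitution
import Summits.KontsevichZagierPeriods.Zeta5Search.CellularCubicalMap
import HarnessLib

/-!
# ζ(5) search — Brown–Zudilin's cubical form (8) PROVED: `cellularIntegral_eq_cubicalIntegral` holds (cell `pub-zeta5`, seat ct-1 g10)

HONEST FRAMING: systematic search; no irrationality claim unless kernel-certified. Nothing in this file is an irrationality
result, a worthiness exponent or a denominator statement. It DISCHARGES the named Literature fact
`Literature.NumberTheory.Irrationality.BrownZudilin2022.cellularIntegral_eq_cubicalIntegral` [BrownZudilin2022, Sect. 3, eq. (8)]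
("Applying to the integral `I(a) = I(a₁,…,a₈)` the fifth power of `σ` and passing from simplicial to cubical coordinates … we
arrive at the integral (8)"; the source omits the finite calculation, `CubicalForm.lean` typed the statement only):
for EVERY `a : Fin 8 → ℤ` (no convergence hypothesis — both sides are Bochner integrals and the change of variables needs no
integrability) the simplicial integral (1) `cellularIntegral a = ∫_{openSimplex} integrand a` equals the cubical integral (8)
`cubicalIntegral a = ∫_{(0,1)⁵} cubicalIntegrand a` (`cellularIntegral_eq_cubicalIntegral_all`, `cellularIntegral_eq_cubicalIntegral_holds`).

Proof. The map `Ψ = σ⁵ ∘ c` (closed form and bijectivity `(0,1)⁵ → openSimplex` in `CellularCubicalMap.lean`) is differentiable on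
the cube; its derivative is the continuous linear map with the fourteen non-zero partial derivatives listed in `hasFDerivAt_psi`,
and its Jacobian determinant is `−x₂x₃²x₄(1−x₃)⁴(1−x₄)⁴/((1−x₁x₂x₃)²(1−x₂x₃)²(1−x₃x₄)⁶(1−x₄x₅)²)` (the value recorded in the
remarks of `CubicalForm.lean`; `det_pattern14` expands the sparse `5 × 5` determinant). The POINTWISE identity
`|det DΨ(x)| · integrand a (Ψ x) = cubicalIntegrand a x` (`integrand_psi`) is an identity of Laurent monomials in the positive
atoms `xⱼ, 1−xⱼ, 1−x₁x₂, 1−x₂x₃, 1−x₃x₄, 1−x₄x₅, 1−x₁x₂x₃`, obtained from the difference identities of `CellularCubicalMap.lean`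
and proved by comparing logarithms. Mathlib's `integral_image_eq_integral_abs_det_fderiv_smul` concludes.

Consequence for the tree: with `CubicalSubstitution.cubicalIntegral_eq_Jintegral_holds` (eq. (10)) BOTH hypotheses `h8`, `h10`
("F1") of the gen-1 (H1)-free cellular-relation files `WedgeDictionaryKernel{Cells,Atlas,Trans}*` are now theorems; those files
keep only F2 = `barnes_double` (the Barnes representation (16)) as a named-fact input.
-/

namespace Summit.KontsevichZagierPeriods.Zeta5Search.CellularCubicalSubstitution

open MeasureTheory Set
open ContinuousLinearMap (proj)
open Literature.NumberTheory.Irrationality.BrownZudilin2022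
open Summit.KontsevichZagierPeriods.Zeta5Search.CellularCubicalMap

/-! ### Derivatives of the components of `Ψ` -/

/-- Quotient rule for real functions on `ℝ⁵`. -/
theorem hasFDerivAt_div' {f g : (Fin 5 → ℝ) → ℝ} {f' g' : (Fin 5 → ℝ) →L[ℝ] ℝ} {x : Fin 5 → ℝ}
    (hf : HasFDerivAt f f' x) (hg : HasFDerivAt g g' x) (hg0 : g x ≠ 0) :
    HasFDerivAt (fun y => f y / g y) ((g x)⁻¹ • f' - (f x / g x ^ 2) • g') x := by
  have h := hf.mul ((hasFDerivAt_inv hg0).comp x hg)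
  refine HasFDerivAt.congr_fderiv (h.congr_of_eventuallyEq ?_) ?_
  · exact Filter.Eventually.of_forall fun z => by simp [div_eq_mul_inv]
  · ext v
    simp
    ring

/-- The coordinate functions are their own derivatives. -/
theorem hasFDerivAt_coord (i : Fin 5) (x : Fin 5 → ℝ) :
    HasFDerivAt (fun y : Fin 5 → ℝ => y i) (proj i : (Fin 5 → ℝ) →L[ℝ] ℝ) x :=
  hasFDerivAt_apply (𝕜 := ℝ) i x

/-- Derivative of `Ψ₃ = (1 − x₃)/(1 − x₃x₄)`. -/
theorem hasFDerivAt_psi2 (x : Fin 5 → ℝ) (hP : 1 - x 2 * x 3 ≠ 0) :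
    HasFDerivAt (fun y : Fin 5 → ℝ => (1 - y 2) / (1 - y 2 * y 3))
      (((x 3 - 1) / (1 - x 2 * x 3) ^ 2) • (proj 2 : (Fin 5 → ℝ) →L[ℝ] ℝ)
        + ((1 - x 2) * x 2 / (1 - x 2 * x 3) ^ 2) • (proj 3 : (Fin 5 → ℝ) →L[ℝ] ℝ)) x := by
  have hN := (hasFDerivAt_coord 2 x).const_sub 1
  have hD := ((hasFDerivAt_coord 2 x).mul (hasFDerivAt_coord 3 x)).const_sub 1
  refine HasFDerivAt.congr_fderiv ((hasFDerivAt_div' hN hD hP).congr_of_eventuallyEq ?_) ?_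
  · exact Filter.Eventually.of_forall fun z => by simp
  · ext v
    simp
    field_simp
    ring

/-- Derivative of `Ψ₂ = x₄(1 − x₃)/(1 − x₃x₄)`. -/
theorem hasFDerivAt_psi1 (x : Fin 5 → ℝ) (hP : 1 - x 2 * x 3 ≠ 0) :
    HasFDerivAt (fun y : Fin 5 → ℝ => y 3 * (1 - y 2) / (1 - y 2 * y 3))
      ((x 3 * (x 3 - 1) / (1 - x 2 * x 3) ^ 2) • (proj 2 : (Fin 5 → ℝ) →L[ℝ] ℝ)
        + ((1 - x 2) / (1 - x 2 * x 3) ^ 2) • (proj 3 : (Fin 5 → ℝ) →L[ℝ] ℝ)) x := by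
  have hN := (hasFDerivAt_coord 3 x).mul ((hasFDerivAt_coord 2 x).const_sub 1)
  have hD := ((hasFDerivAt_coord 2 x).mul (hasFDerivAt_coord 3 x)).const_sub 1
  refine HasFDerivAt.congr_fderiv ((hasFDerivAt_div' hN hD hP).congr_of_eventuallyEq ?_) ?_
  · exact Filter.Eventually.of_forall fun z => by simp
  · ext v
    simp
    field_simp
    ring

/-- Derivative of `Ψ₁ = x₄(1 − x₃)(1 − x₅)/((1 − x₃x₄)(1 − x₄x₅))`. -/
theorem hasFDerivAt_psi0 (x : Fin 5 → ℝ) (hP : 1 - x 2 * x 3 ≠ 0) (hQ : 1 - x 3 * x 4 ≠ 0) :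
    HasFDerivAt (fun y : Fin 5 → ℝ => y 3 * (1 - y 2) * (1 - y 4) / ((1 - y 2 * y 3) * (1 - y 3 * y 4)))
      ((x 3 * (x 3 - 1) * (1 - x 4) / ((1 - x 2 * x 3) ^ 2 * (1 - x 3 * x 4))) • (proj 2 : (Fin 5 → ℝ) →L[ℝ] ℝ)
        + ((1 - x 2) * (1 - x 4) * (1 - x 2 * x 3 ^ 2 * x 4) / ((1 - x 2 * x 3) ^ 2 * (1 - x 3 * x 4) ^ 2)) •
            (proj 3 : (Fin 5 → ℝ) →L[ℝ] ℝ)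
        + ((x 3 * (1 - x 2) * (x 3 - 1)) / ((1 - x 2 * x 3) * (1 - x 3 * x 4) ^ 2)) • (proj 4 : (Fin 5 → ℝ) →L[ℝ] ℝ))
      x := by
  have hN := ((hasFDerivAt_coord 3 x).mul ((hasFDerivAt_coord 2 x).const_sub 1)).mul
    ((hasFDerivAt_coord 4 x).const_sub 1)
  have hD := (((hasFDerivAt_coord 2 x).mul (hasFDerivAt_coord 3 x)).const_sub 1).mul
    (((hasFDerivAt_coord 3 x).mul (hasFDerivAt_coord 4 x)).const_sub 1)
  refine HasFDerivAt.congr_fderiv ((hasFDerivAt_div' hN hD (mul_ne_zero hP hQ)).congr_of_eventuallyEq ?_) ?_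
  · exact Filter.Eventually.of_forall fun z => by simp
  · ext v
    simp
    field_simp
    ring

/-- Derivative of `Ψ₄ = (1 − x₃)(1 − x₁x₂x₃x₄)/((1 − x₁x₂x₃)(1 − x₃x₄))`. -/
theorem hasFDerivAt_psi3 (x : Fin 5 → ℝ) (hP : 1 - x 2 * x 3 ≠ 0) (hU : 1 - x 0 * x 1 * x 2 ≠ 0) :
    HasFDerivAt (fun y : Fin 5 → ℝ => (1 - y 2) * (1 - y 0 * y 1 * y 2 * y 3) / ((1 - y 0 * y 1 * y 2) * (1 - y 2 * y 3)))
      (((1 - x 2) * (1 - x 3) * x 1 * x 2 / ((1 - x 2 * x 3) * (1 - x 0 * x 1 * x 2) ^ 2)) • (proj 0 : (Fin 5 → ℝ) →L[ℝ] ℝ)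
        + ((1 - x 2) * (1 - x 3) * x 0 * x 2 / ((1 - x 2 * x 3) * (1 - x 0 * x 1 * x 2) ^ 2)) •
            (proj 1 : (Fin 5 → ℝ) →L[ℝ] ℝ)
        + ((x 3 - 1) * (1 - x 0 * x 1) * (1 - x 0 * x 1 * x 2 ^ 2 * x 3) / ((1 - x 2 * x 3) ^ 2 * (1 - x 0 * x 1 * x 2) ^ 2)) •
            (proj 2 : (Fin 5 → ℝ) →L[ℝ] ℝ)
        + ((1 - x 2) * x 2 * (1 - x 0 * x 1) / ((1 - x 2 * x 3) ^ 2 * (1 - x 0 * x 1 * x 2))) •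
            (proj 3 : (Fin 5 → ℝ) →L[ℝ] ℝ)) x := by
  have hN := ((hasFDerivAt_coord 2 x).const_sub 1).mul
    (((((hasFDerivAt_coord 0 x).mul (hasFDerivAt_coord 1 x)).mul (hasFDerivAt_coord 2 x)).mul
      (hasFDerivAt_coord 3 x)).const_sub 1)
  have hD := ((((hasFDerivAt_coord 0 x).mul (hasFDerivAt_coord 1 x)).mul (hasFDerivAt_coord 2 x)).const_sub 1).mul
    (((hasFDerivAt_coord 2 x).mul (hasFDerivAt_coord 3 x)).const_sub 1)
  refine HasFDerivAt.congr_fderiv ((hasFDerivAt_div' hN hD (mul_ne_zero hU hP)).congr_of_eventuallyEq ?_) ?_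
  · exact Filter.Eventually.of_forall fun z => by simp
  · ext v
    simp
    field_simp
    ring

/-- Derivative of `Ψ₅ = (1 − x₃)(1 − x₂x₃x₄)/((1 − x₂x₃)(1 − x₃x₄))`. -/
theorem hasFDerivAt_psi4 (x : Fin 5 → ℝ) (hP : 1 - x 2 * x 3 ≠ 0) (hW : 1 - x 1 * x 2 ≠ 0) :
    HasFDerivAt (fun y : Fin 5 → ℝ => (1 - y 2) * (1 - y 1 * y 2 * y 3) / ((1 - y 1 * y 2) * (1 - y 2 * y 3)))
      (((1 - x 2) * (1 - x 3) * x 2 / ((1 - x 2 * x 3) * (1 - x 1 * x 2) ^ 2)) • (proj 1 : (Fin 5 → ℝ) →L[ℝ] ℝ)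
        + ((x 3 - 1) * (1 - x 1) * (1 - x 1 * x 2 ^ 2 * x 3) / ((1 - x 2 * x 3) ^ 2 * (1 - x 1 * x 2) ^ 2)) •
            (proj 2 : (Fin 5 → ℝ) →L[ℝ] ℝ)
        + ((1 - x 2) * x 2 * (1 - x 1) / ((1 - x 2 * x 3) ^ 2 * (1 - x 1 * x 2))) •
            (proj 3 : (Fin 5 → ℝ) →L[ℝ] ℝ)) x := by
  have hN := ((hasFDerivAt_coord 2 x).const_sub 1).mul
    ((((hasFDerivAt_coord 1 x).mul (hasFDerivAt_coord 2 x)).mul (hasFDerivAt_coord 3 x)).const_sub 1)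
  have hD := (((hasFDerivAt_coord 1 x).mul (hasFDerivAt_coord 2 x)).const_sub 1).mul
    (((hasFDerivAt_coord 2 x).mul (hasFDerivAt_coord 3 x)).const_sub 1)
  refine HasFDerivAt.congr_fderiv ((hasFDerivAt_div' hN hD (mul_ne_zero hW hP)).congr_of_eventuallyEq ?_) ?_
  · exact Filter.Eventually.of_forall fun z => by simp
  · ext v
    simp
    field_simp
    ring

/-- Determinant of a `5 × 5` matrix with the zero pattern of `DΨ`. -/
theorem det_pattern14 (a b c d e f g h i j k l m n : ℝ) :
    Matrix.det !![0, 0, a, b, c; 0, 0, d, e, 0; 0, 0, f, g, 0; h, i, j, k, 0; 0, l, m, n, 0]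
      = h * l * c * (d * g - e * f) := by
  have s12 : (Fin.succAbove (1 : Fin 5) (2 : Fin 4)) = 3 := by decide
  have s13 : (Fin.succAbove (1 : Fin 5) (3 : Fin 4)) = 4 := by decide
  have s23 : (Fin.succAbove (2 : Fin 5) (3 : Fin 4)) = 4 := by decide
  have s22 : (Fin.succAbove (2 : Fin 5) (2 : Fin 4)) = 3 := by decide
  have s32 : (Fin.succAbove (3 : Fin 5) (2 : Fin 4)) = 2 := by decide
  have s33 : (Fin.succAbove (3 : Fin 5) (3 : Fin 4)) = 4 := by decide
  have s42 : (Fin.succAbove (4 : Fin 5) (2 : Fin 4)) = 2 := by decide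
  have s43 : (Fin.succAbove (4 : Fin 5) (3 : Fin 4)) = 3 := by decide
  have t12 : (Fin.succAbove (1 : Fin 4) (2 : Fin 3)) = 3 := by decide
  have t22 : (Fin.succAbove (2 : Fin 4) (2 : Fin 3)) = 3 := by decide
  have t32 : (Fin.succAbove (3 : Fin 4) (2 : Fin 3)) = 2 := by decide
  simp [Matrix.det_succ_row_zero, Fin.sum_univ_succ, Matrix.submatrix, s12, s13, s23, s22, s32, s33, s42, s43, t12, t22, t32]
  ring

/-- **`Ψ` is differentiable on the cube, with Jacobian determinant
`det DΨ(x) = −x₂x₃²x₄(1−x₃)⁴(1−x₄)⁴/((1−x₁x₂x₃)²(1−x₂x₃)²(1−x₃x₄)⁶(1−x₄x₅)²)`** (the value recorded in `CubicalForm.lean`'s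
remarks). The derivative is the continuous linear map whose rows are the fourteen partial derivatives below. -/
theorem hasFDerivAt_psi (x : Fin 5 → ℝ) (hP : 1 - x 2 * x 3 ≠ 0) (hQ : 1 - x 3 * x 4 ≠ 0) (hW : 1 - x 1 * x 2 ≠ 0)
    (hU : 1 - x 0 * x 1 * x 2 ≠ 0) :
    ∃ f' : (Fin 5 → ℝ) →L[ℝ] (Fin 5 → ℝ),
      HasFDerivAt (fun x : Fin 5 → ℝ => ![x 3 * (1 - x 2) * (1 - x 4) / ((1 - x 2 * x 3) * (1 - x 3 * x 4)),
          x 3 * (1 - x 2) / (1 - x 2 * x 3),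
          (1 - x 2) / (1 - x 2 * x 3),
          (1 - x 2) * (1 - x 0 * x 1 * x 2 * x 3) / ((1 - x 0 * x 1 * x 2) * (1 - x 2 * x 3)),
          (1 - x 2) * (1 - x 1 * x 2 * x 3) / ((1 - x 1 * x 2) * (1 - x 2 * x 3))]) f' x
      ∧ f'.det = -(x 1 * x 2 ^ 2 * x 3 * (1 - x 2) ^ 4 * (1 - x 3) ^ 4 /
          ((1 - x 0 * x 1 * x 2) ^ 2 * (1 - x 1 * x 2) ^ 2 * (1 - x 2 * x 3) ^ 6 * (1 - x 3 * x 4) ^ 2)) := by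
  refine ⟨ContinuousLinearMap.pi
    ![(x 3 * (x 3 - 1) * (1 - x 4) / ((1 - x 2 * x 3) ^ 2 * (1 - x 3 * x 4))) • (proj 2 : (Fin 5 → ℝ) →L[ℝ] ℝ)
        + ((1 - x 2) * (1 - x 4) * (1 - x 2 * x 3 ^ 2 * x 4) / ((1 - x 2 * x 3) ^ 2 * (1 - x 3 * x 4) ^ 2)) •
            (proj 3 : (Fin 5 → ℝ) →L[ℝ] ℝ)
        + ((x 3 * (1 - x 2) * (x 3 - 1)) / ((1 - x 2 * x 3) * (1 - x 3 * x 4) ^ 2)) • (proj 4 : (Fin 5 → ℝ) →L[ℝ] ℝ),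
      (x 3 * (x 3 - 1) / (1 - x 2 * x 3) ^ 2) • (proj 2 : (Fin 5 → ℝ) →L[ℝ] ℝ)
        + ((1 - x 2) / (1 - x 2 * x 3) ^ 2) • (proj 3 : (Fin 5 → ℝ) →L[ℝ] ℝ),
      ((x 3 - 1) / (1 - x 2 * x 3) ^ 2) • (proj 2 : (Fin 5 → ℝ) →L[ℝ] ℝ)
        + ((1 - x 2) * x 2 / (1 - x 2 * x 3) ^ 2) • (proj 3 : (Fin 5 → ℝ) →L[ℝ] ℝ),
      ((1 - x 2) * (1 - x 3) * x 1 * x 2 / ((1 - x 2 * x 3) * (1 - x 0 * x 1 * x 2) ^ 2)) • (proj 0 : (Fin 5 → ℝ) →L[ℝ] ℝ)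
        + ((1 - x 2) * (1 - x 3) * x 0 * x 2 / ((1 - x 2 * x 3) * (1 - x 0 * x 1 * x 2) ^ 2)) •
            (proj 1 : (Fin 5 → ℝ) →L[ℝ] ℝ)
        + ((x 3 - 1) * (1 - x 0 * x 1) * (1 - x 0 * x 1 * x 2 ^ 2 * x 3) / ((1 - x 2 * x 3) ^ 2 * (1 - x 0 * x 1 * x 2) ^ 2)) •
            (proj 2 : (Fin 5 → ℝ) →L[ℝ] ℝ)
        + ((1 - x 2) * x 2 * (1 - x 0 * x 1) / ((1 - x 2 * x 3) ^ 2 * (1 - x 0 * x 1 * x 2))) •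
            (proj 3 : (Fin 5 → ℝ) →L[ℝ] ℝ),
      ((1 - x 2) * (1 - x 3) * x 2 / ((1 - x 2 * x 3) * (1 - x 1 * x 2) ^ 2)) • (proj 1 : (Fin 5 → ℝ) →L[ℝ] ℝ)
        + ((x 3 - 1) * (1 - x 1) * (1 - x 1 * x 2 ^ 2 * x 3) / ((1 - x 2 * x 3) ^ 2 * (1 - x 1 * x 2) ^ 2)) •
            (proj 2 : (Fin 5 → ℝ) →L[ℝ] ℝ)
        + ((1 - x 2) * x 2 * (1 - x 1) / ((1 - x 2 * x 3) ^ 2 * (1 - x 1 * x 2))) •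
            (proj 3 : (Fin 5 → ℝ) →L[ℝ] ℝ)], ?_, ?_⟩
  · refine hasFDerivAt_pi'' fun k => ?_
    rw [ContinuousLinearMap.proj_pi]
    fin_cases k
    · simpa using hasFDerivAt_psi0 x hP hQ
    · simpa using hasFDerivAt_psi1 x hP
    · simpa using hasFDerivAt_psi2 x hP
    · simpa using hasFDerivAt_psi3 x hP hU
    · simpa using hasFDerivAt_psi4 x hP hW
  · rw [ContinuousLinearMap.det, ← LinearMap.det_toMatrix']
    rw [show LinearMap.toMatrix' _ = !![0, 0, x 3 * (x 3 - 1) * (1 - x 4) / ((1 - x 2 * x 3) ^ 2 * (1 - x 3 * x 4)),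
          (1 - x 2) * (1 - x 4) * (1 - x 2 * x 3 ^ 2 * x 4) / ((1 - x 2 * x 3) ^ 2 * (1 - x 3 * x 4) ^ 2),
          (x 3 * (1 - x 2) * (x 3 - 1)) / ((1 - x 2 * x 3) * (1 - x 3 * x 4) ^ 2);
        0, 0, x 3 * (x 3 - 1) / (1 - x 2 * x 3) ^ 2, (1 - x 2) / (1 - x 2 * x 3) ^ 2, 0;
        0, 0, (x 3 - 1) / (1 - x 2 * x 3) ^ 2, (1 - x 2) * x 2 / (1 - x 2 * x 3) ^ 2, 0;
        (1 - x 2) * (1 - x 3) * x 1 * x 2 / ((1 - x 2 * x 3) * (1 - x 0 * x 1 * x 2) ^ 2),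
          (1 - x 2) * (1 - x 3) * x 0 * x 2 / ((1 - x 2 * x 3) * (1 - x 0 * x 1 * x 2) ^ 2),
          (x 3 - 1) * (1 - x 0 * x 1) * (1 - x 0 * x 1 * x 2 ^ 2 * x 3) / ((1 - x 2 * x 3) ^ 2 * (1 - x 0 * x 1 * x 2) ^ 2),
          (1 - x 2) * x 2 * (1 - x 0 * x 1) / ((1 - x 2 * x 3) ^ 2 * (1 - x 0 * x 1 * x 2)), 0;
        0, (1 - x 2) * (1 - x 3) * x 2 / ((1 - x 2 * x 3) * (1 - x 1 * x 2) ^ 2),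
          (x 3 - 1) * (1 - x 1) * (1 - x 1 * x 2 ^ 2 * x 3) / ((1 - x 2 * x 3) ^ 2 * (1 - x 1 * x 2) ^ 2),
          (1 - x 2) * x 2 * (1 - x 1) / ((1 - x 2 * x 3) ^ 2 * (1 - x 1 * x 2)), 0] from by
      ext i j
      rw [LinearMap.toMatrix'_apply]
      fin_cases i <;> fin_cases j <;> simp]
    rw [det_pattern14]
    set P := 1 - x 2 * x 3 with hPdef
    set Q := 1 - x 3 * x 4 with hQdef
    set W := 1 - x 1 * x 2 with hWdef
    set U := 1 - x 0 * x 1 * x 2 with hUdef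
    have e : x 3 * (x 3 - 1) / P ^ 2 * ((1 - x 2) * x 2 / P ^ 2) - (1 - x 2) / P ^ 2 * ((x 3 - 1) / P ^ 2)
        = (1 - x 2) * (1 - x 3) / P ^ 3 := by
      have hP3 : P ^ 3 ≠ 0 := pow_ne_zero 3 hP
      have hP4 : P ^ 2 * P ^ 2 ≠ 0 := mul_ne_zero (pow_ne_zero 2 hP) (pow_ne_zero 2 hP)
      rw [div_mul_div_comm, div_mul_div_comm, ← sub_div, div_eq_div_iff hP4 hP3, hPdef]
      ring
    rw [e]
    field_simp
    ring

/-! ### The pointwise identity of the integrands -/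

/-- **Pointwise identity in coordinates:** for `0 < xⱼ < 1` and EVERY `a : Fin 8 → ℤ`,
`|det DΨ(x)| · integrand a (Ψ x) = cubicalIntegrand a x` — every factor `tⱼ − tᵢ`, `1 − tⱼ`, `tⱼ` of the integrand (1) at
`t = Ψ(x)` is a Laurent monomial in the positive atoms (the difference identities of `CellularCubicalMap.lean`); compare logarithms. -/
theorem integrand_psi_coord (a : Fin 8 → ℤ) (x0 x1 x2 x3 x4 : ℝ)
    (h0 : 0 < x0) (h0' : x0 < 1) (h1 : 0 < x1) (h1' : x1 < 1) (h2 : 0 < x2) (h2' : x2 < 1)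
    (h3 : 0 < x3) (h3' : x3 < 1) (h4 : 0 < x4) (h4' : x4 < 1) :
    x1 * x2 ^ 2 * x3 * (1 - x2) ^ 4 * (1 - x3) ^ 4 /
          ((1 - x0 * x1 * x2) ^ 2 * (1 - x1 * x2) ^ 2 * (1 - x2 * x3) ^ 6 * (1 - x3 * x4) ^ 2) *
        integrand a ![x3 * (1 - x2) * (1 - x4) / ((1 - x2 * x3) * (1 - x3 * x4)),
          x3 * (1 - x2) / (1 - x2 * x3),
          (1 - x2) / (1 - x2 * x3),
          (1 - x2) * (1 - x0 * x1 * x2 * x3) / ((1 - x0 * x1 * x2) * (1 - x2 * x3)),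
          (1 - x2) * (1 - x1 * x2 * x3) / ((1 - x1 * x2) * (1 - x2 * x3))]
      = cubicalIntegrand a ![x0, x1, x2, x3, x4] := by
  have u0 : 0 < 1 - x0 := by linarith
  have u1 : 0 < 1 - x1 := by linarith
  have u2 : 0 < 1 - x2 := by linarith
  have u3 : 0 < 1 - x3 := by linarith
  have u4 : 0 < 1 - x4 := by linarith
  have p01 : 0 < x0 * x1 := mul_pos h0 h1
  have hV : 0 < 1 - x0 * x1 := by nlinarith [mul_lt_of_lt_one_right h0 h1']
  obtain ⟨hP, hQ, hW, hU⟩ := atoms_pos h0 h0' h1 h1' h2 h2' h3 h3' h4'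
  simp only [integrand, cubicalIntegrand, b24, b14, b57, b35, b36, xExp, oneSubExp, linkExp, Matrix.cons_val_zero,
    Matrix.cons_val_one, Matrix.cons_val]
  rw [psi_d10 hP.ne' hQ.ne', psi_d21 hP.ne', psi_d32 hP.ne' hU.ne', psi_d43 hP.ne' hU.ne' hW.ne', psi_d54 hP.ne' hW.ne',
    psi_d20 hP.ne' hQ.ne', psi_d53 hP.ne' hU.ne', psi_d31 hP.ne' hU.ne', psi_d41 hP.ne' hW.ne']
  set v0 := 1 - x0 with hv0
  set v1 := 1 - x1 with hv1
  set v2 := 1 - x2 with hv2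
  set v3 := 1 - x3 with hv3
  set v4 := 1 - x4 with hv4
  set V := 1 - x0 * x1 with hVd
  set W := 1 - x1 * x2 with hWd
  set P := 1 - x2 * x3 with hPd
  set Q := 1 - x3 * x4 with hQd
  set U := 1 - x0 * x1 * x2 with hUd
  clear_value v0 v1 v2 v3 v4 V W P Q U
  refine (Real.log_injOn_pos.eq_iff ?_ ?_).1 ?_
  · rw [Set.mem_Ioi]; positivity
  · rw [Set.mem_Ioi]; positivity
  simp (disch := positivity) only [Real.log_mul, Real.log_div, Real.log_zpow, Real.log_pow]
  push_cast
  ring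

/-- The pointwise identity on the open cube, in the form used by the change of variables. -/
theorem integrand_psi (a : Fin 8 → ℤ) {x : Fin 5 → ℝ} (hx : x ∈ openCube) :
    x 1 * x 2 ^ 2 * x 3 * (1 - x 2) ^ 4 * (1 - x 3) ^ 4 /
          ((1 - x 0 * x 1 * x 2) ^ 2 * (1 - x 1 * x 2) ^ 2 * (1 - x 2 * x 3) ^ 6 * (1 - x 3 * x 4) ^ 2) *
        integrand a ![x 3 * (1 - x 2) * (1 - x 4) / ((1 - x 2 * x 3) * (1 - x 3 * x 4)),
          x 3 * (1 - x 2) / (1 - x 2 * x 3),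
          (1 - x 2) / (1 - x 2 * x 3),
          (1 - x 2) * (1 - x 0 * x 1 * x 2 * x 3) / ((1 - x 0 * x 1 * x 2) * (1 - x 2 * x 3)),
          (1 - x 2) * (1 - x 1 * x 2 * x 3) / ((1 - x 1 * x 2) * (1 - x 2 * x 3))]
      = cubicalIntegrand a x := by
  obtain ⟨a0, b0⟩ := hx 0; obtain ⟨a1, b1⟩ := hx 1; obtain ⟨a2, b2⟩ := hx 2; obtain ⟨a3, b3⟩ := hx 3
  obtain ⟨a4, b4⟩ := hx 4
  have hx' : x = ![x 0, x 1, x 2, x 3, x 4] := by ext i; fin_cases i <;> simp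
  conv_rhs => rw [hx']
  exact integrand_psi_coord a (x 0) (x 1) (x 2) (x 3) (x 4) a0 b0 a1 b1 a2 b2 a3 b3 a4 b4

/-! ### The change of variables -/

/-- **(8) for every parameter vector:** `cellularIntegral a = cubicalIntegral a` for ALL `a : Fin 8 → ℤ` (no convergence
hypothesis: the change-of-variables formula for the injective differentiable map `Ψ = σ⁵ ∘ c` on the measurable set `(0,1)⁵`,
whose image is the open simplex, holds for the Bochner integral unconditionally). -/
theorem cellularIntegral_eq_cubicalIntegral_all (a : Fin 8 → ℤ) : cellularIntegral a = cubicalIntegral a := by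
  -- a derivative at every point of the cube (junk `0` elsewhere, where nothing is claimed)
  have hex : ∀ x : Fin 5 → ℝ, ∃ f' : (Fin 5 → ℝ) →L[ℝ] (Fin 5 → ℝ), x ∈ openCube →
      HasFDerivAt (fun x : Fin 5 → ℝ => ![x 3 * (1 - x 2) * (1 - x 4) / ((1 - x 2 * x 3) * (1 - x 3 * x 4)),
          x 3 * (1 - x 2) / (1 - x 2 * x 3),
          (1 - x 2) / (1 - x 2 * x 3),
          (1 - x 2) * (1 - x 0 * x 1 * x 2 * x 3) / ((1 - x 0 * x 1 * x 2) * (1 - x 2 * x 3)),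
          (1 - x 2) * (1 - x 1 * x 2 * x 3) / ((1 - x 1 * x 2) * (1 - x 2 * x 3))]) f' x
        ∧ f'.det = -(x 1 * x 2 ^ 2 * x 3 * (1 - x 2) ^ 4 * (1 - x 3) ^ 4 /
            ((1 - x 0 * x 1 * x 2) ^ 2 * (1 - x 1 * x 2) ^ 2 * (1 - x 2 * x 3) ^ 6 * (1 - x 3 * x 4) ^ 2)) := by
    intro x
    by_cases hx : x ∈ openCube
    · obtain ⟨hP, hQ, hW, hU⟩ :=
        atoms_pos (hx 0).1 (hx 0).2 (hx 1).1 (hx 1).2 (hx 2).1 (hx 2).2 (hx 3).1 (hx 3).2 (hx 4).2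
      obtain ⟨f', hf'⟩ := hasFDerivAt_psi x hP.ne' hQ.ne' hW.ne' hU.ne'
      exact ⟨f', fun _ => hf'⟩
    · exact ⟨0, fun h => (hx h).elim⟩
  choose f' hf' using hex
  have hderiv : ∀ x ∈ openCube, HasFDerivWithinAt
      (fun x : Fin 5 → ℝ => ![x 3 * (1 - x 2) * (1 - x 4) / ((1 - x 2 * x 3) * (1 - x 3 * x 4)),
          x 3 * (1 - x 2) / (1 - x 2 * x 3),
          (1 - x 2) / (1 - x 2 * x 3),
          (1 - x 2) * (1 - x 0 * x 1 * x 2 * x 3) / ((1 - x 0 * x 1 * x 2) * (1 - x 2 * x 3)),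
          (1 - x 2) * (1 - x 1 * x 2 * x 3) / ((1 - x 1 * x 2) * (1 - x 2 * x 3))]) (f' x) openCube x :=
    fun x hx => (hf' x hx).1.hasFDerivWithinAt
  have hcv := integral_image_eq_integral_abs_det_fderiv_smul volume CubicalSubstitution.measurableSet_openCube hderiv
    psi_injOn (integrand a)
  rw [psi_image] at hcv
  rw [cellularIntegral, hcv, cubicalIntegral]
  refine setIntegral_congr_fun CubicalSubstitution.measurableSet_openCube fun x hx => ?_
  obtain ⟨a0, b0⟩ := hx 0; obtain ⟨a1, b1⟩ := hx 1; obtain ⟨a2, b2⟩ := hx 2; obtain ⟨a3, b3⟩ := hx 3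
  obtain ⟨a4, b4⟩ := hx 4
  obtain ⟨hP, hQ, hW, hU⟩ := atoms_pos a0 b0 a1 b1 a2 b2 a3 b3 b4
  have u2 : 0 < 1 - x 2 := by linarith
  have u3 : 0 < 1 - x 3 := by linarith
  rw [(hf' x hx).2, abs_neg, abs_of_pos (by positivity), smul_eq_mul]
  exact integrand_psi a hx

/-- **Brown–Zudilin (8) holds:** the named fact `cellularIntegral_eq_cubicalIntegral` of `CubicalForm.lean` ("Applying to the
integral `I(a)` the fifth power of `σ` and passing from simplicial to cubical coordinates … we arrive at the integral (8)") is a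
theorem. [BrownZudilin2022, Sect. 3, eq. (8)] -/
theorem cellularIntegral_eq_cubicalIntegral_holds : cellularIntegral_eq_cubicalIntegral :=
  fun a _ => cellularIntegral_eq_cubicalIntegral_all a

/-- **Corollary: (1) = (10).** For every `a`, the cellular integral `I(a)` of (1) equals the 12-parameter integral
`J(p(a); q(a))` of (10) (both changes of variables of Sect. 3 composed). [BrownZudilin2022, Sect. 3, (8), (10)–(11)] -/
theorem cellularIntegral_eq_Jintegral (a : Fin 8 → ℤ) : cellularIntegral a = Jintegral (pOf a) (qOf a) := by
  rw [cellularIntegral_eq_cubicalIntegral_all, CubicalSubstitution.cubicalIntegral_eq_Jintegral_all]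

end Summit.KontsevichZagierPeriods.Zeta5Search.CellularCubicalSubstitution
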